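import Summits.HodgeConjecture.CorCM.GaloisQuaternionCompositum
import Summits.HodgeConjecture.CorCM.TransversalAvoidingTranslate
import HarnessLib

/-!
# Composita `K = M · L`: TRANSVERSAL types — gen 19's mechanism over an arbitrary Galois CM field `L`

COR-CM (cell `pub-hodgecm2`), binder seat b04 (gen 24), count-neutral claim REAL-FACTOR, part II (NAME ACK
`CorCM/GaloisTransversalCompositum`, HOME/INBOX l.10153).  HC_CM is NOT proved here; unconditional negative-side
examples.  KERNEL ONLY: theorems; no definition, no named fact, no `sorry`.

Setting: `Gal(K/ℚ) ≅ H × Γ` with complex conjugation `(1, c₁)` — `K = M · L`, `M = K^Γ` totally real Galois with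
group `H`, `L = K^H` a Galois CM field with group `Γ` and complex conjugation `c₁`, linearly disjoint; `F ⊆ Γ` a
PRIMITIVE CM type of `L` (`v ∈ F ↔ c₁ v ∉ F`, trivial left stabiliser).

THE TRANSVERSAL TYPE.  Let `V ≤ H` be a subgroup with `3 ≤ |V|` and `y₀ ∈ H ∖ V` a non-involution.  Gen 19, part I
(`TwiceOdd.exists_transversal`) gives a right transversal `N ∋ 1` of `V` in `H` with trivial left stabiliser.  Put the
fibre `F` over `N` and the conjugate fibre `Γ ∖ F = c₁F` over `H ∖ N`:

  `T = N × F ∪ (H ∖ N) × c₁F`.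

* `T` is a CM set for `(1, c₁)` and PRIMITIVE: a period `(a, 1)` gives `aN ⊆ N`, so `a = 1`; a period `(a, c₁)` would
  exchange `N` and `H ∖ N`, impossible since `|N| = |H|/|V| ≤ |H|/3`; any other `(a, b)` makes `b` or `c₁ b` a period
  of `F` (look at the fibre over `1 ∈ N`).
* `T` is DEGENERATE: the finite set `D = V × {1} ∪ V y₀ × {c₁}` is balanced — for `g = (g₀, w)` exactly one
  `x ∈ V` has `x g₀ ∈ N` and exactly one has `x y₀ g₀ ∈ N`, so `#{x ∈ D : x g ∈ T} = 1 + (|V| - 1) = |V| = #D / 2`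
  whether `w ∈ F` or not — and `(1, c₁) D ≠ D` (`(1, c₁) ∉ D` as `y₀ ∉ V`); gen 20's certificate format
  `exists_simple_degenerate_of_model_balanced` (Pohlmann/White: a balanced weight that is not conjugation-invariant).

For `Γ = C₂`, `F = {1}` this is literally gen 19 part III (`TwiceOdd.exists_simple_degenerate_of_subgroup`, an
imaginary quadratic `L`); the point of this file is that `Γ` and `F` are ARBITRARY
(`exists_simple_degenerate_of_model_transversal`).  By gen 19 part VIII (`TwiceOdd.dihedral_or_of_forall_mul_self_eq_one`)
the groups `H` with NO such pair `(V, y₀)` are: exponent `≤ 2`, order `4`, prime order, and the dihedral groups `D_p`;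
part III of this claim (`CorCM/GaloisRealFactorDegenerate`) closes `D_p` (`p ≥ 5`) and `C₂ᵏ` (`k ≥ 4`) by admissible
halves (part I, `CorCM/AdmissibleHalvesIndexTwo`).  Numerical check `scratch/g24b.py` (`H ∈ {A₄, C₉, C₃², S₄, C₁₅, Q₈}`,
`Γ ∈ {C₂, C₄, C₆, Q₈}`: CM, primitive, balanced, moved, Kubota rank `< |G|/2 + 1` — 0 failures).

References: Shimura (1998), §6.2 Thm. 3, §8.2 Prop. 26 [cite: Shimura1998]; Gordon (1999), Thm. 6.4, §9.3
[cite: Gordon1999HodgeAVSurvey]; Dodson (1984), §3.1.1 [cite: Dodson1984].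
-/

noncomputable section

open CategoryTheory CategoryTheory.Limits NumberField
open scoped BigOperators

namespace Summit.HodgeConjecture.CorCM.GaloisModels

open Literature.NumberTheory.ComplexMultiplication
open Literature.AlgebraicGeometry.Motives (AbelianVariety CMType)
open Literature.AlgebraicGeometry.HodgeTheory
open Literature.AlgebraicGeometry.ComplexMultiplication (IsCMTypeRealisation)
open Literature.AlgebraicGeometry.Pohlmann1968
open Literature.Barriers.HodgeConjecture (divisorClassesSpan)
open Summit.HodgeConjecture.CorCM.TwiceOdd (exists_transversal card_mul_card_eq)

section Transversal

variable {H Γ : Type*} [Group H] [Fintype H] [DecidableEq H] [Group Γ] [Fintype Γ] [DecidableEq Γ]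
variable {K : Type} [Field K] [NumberField K] [IsCMField K] [IsGalois ℚ K]

/-- **TRANSVERSAL TYPES ARE SIMPLE AND DEGENERATE.**  `Gal(K/ℚ) ≅ H × Γ`, `c = (1, c₁)`; `F ⊆ Γ` a primitive CM set
of `(Γ, c₁)`; `V ≤ H` with `3 ≤ |V|` and a non-involution `y₀ ∈ H ∖ V` ⟹ a SIMPLE DEGENERATE abelian variety of
dimension `|H||Γ|/2` with CM by `K` (the type `N × F ∪ (H ∖ N) × c₁F` over a right transversal `N ∋ 1` of `V` with
trivial left stabiliser; balanced set `V × {1} ∪ V y₀ × {c₁}`), carrying on some power a rational `(p,p)` class outside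
the divisor ring. [cite: Shimura1998, §6.2 Thm. 3 and §8.2 Prop. 26] [cite: Gordon1999HodgeAVSurvey, Thm. 6.4 and §9.3]
[cite: Dodson1984, §3.1.1] -/
theorem exists_simple_degenerate_of_model_transversal (e : (K ≃ₐ[ℚ] K) ≃* H × Γ) (c₁ : Γ)
    (hc : e ((IsCMField.complexConj K).restrictScalars ℚ) = (1, c₁)) (F : Finset Γ)
    (hFcm : ∀ v, v ∈ F ↔ c₁ * v ∉ F) (hFprim : ∀ b : Γ, b ≠ 1 → ∃ v, ¬ (v ∈ F ↔ b * v ∈ F))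
    (V : Subgroup H) (h3 : 3 ≤ Nat.card V) {y₀ : H} (hy₀V : y₀ ∉ V) (hy₀2 : y₀ * y₀ ≠ 1) :
    ∃ (Φ : CMType K) (φ₀ : K →+* ℂ) (A : AbelianVariety ℂ) (ι : 𝓞 K →+* End A)
      (θ : K →+* Module.End ℂ (complexBetti A.X 1)),
      IsPrimitive (ℂ ≃+* ℂ) Φ.1 φ₀ ∧ ¬ IsNondegenerate Φ ∧ IsCMTypeRealisation Φ A ι θ ∧ A.IsSimple ∧
      A.dim = Fintype.card H * Fintype.card Γ / 2 ∧
      ∃ n p : ℕ, ∃ x : complexBetti (⨁ fun _ : Fin n => A).X (2 * p), IsRationalClass x ∧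
        IsOfHodgeType (⨁ fun _ : Fin n => A).dim (⨁ fun _ : Fin n => A).X (2 * p) p p x ∧
        x ∉ divisorClassesSpan (⨁ fun _ : Fin n => A).X (⨁ fun _ : Fin n => A).dim p := by
  classical
  have hcc : c₁ * c₁ = 1 := by
    have h := GaloisRank.model_complexConj_mul_self e hc
    rw [Prod.mk_mul_mk, Prod.mk_eq_one] at h
    exact h.2
  have hc1 : c₁ ≠ 1 := fun h1 => GaloisRank.model_complexConj_ne_one e hc (by rw [h1]; rfl)
  have hcF : ∀ v, c₁ * v ∈ F ↔ v ∉ F := fun v => by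
    have h := hFcm (c₁ * v)
    rwa [← mul_assoc, hcc, one_mul] at h
  -- `F` is nonempty: it contains `1` or `c₁`
  obtain ⟨v₁, hv₁⟩ : ∃ v₁, v₁ ∈ F := by
    by_cases h : (1 : Γ) ∈ F
    · exact ⟨1, h⟩
    · exact ⟨c₁, by rw [← mul_one c₁, hcF]; exact h⟩
  -- the transversal (gen 19, part I)
  obtain ⟨N, -, hN1, hNT, hNstab⟩ := exists_transversal (V := V) (H := (⊤ : Subgroup H)) le_top h3
    (Subgroup.mem_top y₀) hy₀V hy₀2
  have hNcard : N.card * Nat.card V = Fintype.card H := by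
    have h := card_mul_card_eq (le_top : V ≤ ⊤) (N := N) (fun n _ => Subgroup.mem_top n) hNT
    rw [Subgroup.card_top] at h
    rwa [← Nat.card_eq_fintype_card]
  -- the type
  set T : Finset (H × Γ) := Finset.univ.filter fun x => (x.1 ∈ N ∧ x.2 ∈ F) ∨ (x.1 ∉ N ∧ x.2 ∉ F)
    with hT_def
  have hTin : ∀ q v, q ∈ N → ((q, v) ∈ T ↔ v ∈ F) := fun q v hq => by
    simp only [hT_def, Finset.mem_filter, Finset.mem_univ, true_and]; tauto
  have hTout : ∀ q v, q ∉ N → ((q, v) ∈ T ↔ v ∉ F) := fun q v hq => by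
    simp only [hT_def, Finset.mem_filter, Finset.mem_univ, true_and]; tauto
  -- `V` as a finset; exactly one `v ∈ V` with `v y ∈ N`
  set VF : Finset H := Finset.univ.filter fun g => g ∈ V with hVF_def
  have hmemV : ∀ g, g ∈ VF ↔ g ∈ V := fun g => by rw [hVF_def, Finset.mem_filter]; simp
  have hVFc : VF.card = Nat.card V := by rw [hVF_def, Nat.card_eq_fintype_card, ← Fintype.card_subtype]
  have hrow : ∀ y : H, (VF.filter fun v => v * y ∈ N).card = 1 := by
    intro y
    obtain ⟨v, hv, hvy, huniq⟩ := hNT y (Subgroup.mem_top y)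
    rw [Finset.card_eq_one]
    refine ⟨v, Finset.ext fun v' => ?_⟩
    rw [Finset.mem_filter, Finset.mem_singleton, hmemV]
    constructor
    · rintro ⟨hv', hv'y⟩; exact huniq v' hv' hv'y
    · rintro rfl; exact ⟨hv, hvy⟩
  have hrow' : ∀ y : H, (VF.filter fun v => v * y ∉ N).card = Nat.card V - 1 := by
    intro y
    have h := Finset.card_filter_add_card_filter_not (s := VF) (fun v => v * y ∈ N)
    rw [hrow y, hVFc] at h
    omega
  -- the balanced set `D = V × {1} ∪ V y₀ × {c₁}`
  let ι₁ : H ↪ H × Γ := ⟨fun v => (v, 1), fun a b h => (Prod.ext_iff.1 h).1⟩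
  let ι₂ : H ↪ H × Γ := ⟨fun v => (v * y₀, c₁), fun a b h => mul_right_cancel (Prod.ext_iff.1 h).1⟩
  have hdisj : Disjoint (VF.map ι₁) (VF.map ι₂) := by
    rw [Finset.disjoint_left]
    intro x h1 h2
    obtain ⟨a, -, rfl⟩ := Finset.mem_map.1 h1
    obtain ⟨b, -, hb⟩ := Finset.mem_map.1 h2
    exact hc1 (Prod.ext_iff.1 hb).2
  set D : Finset (H × Γ) := VF.map ι₁ ∪ VF.map ι₂ with hD_def
  have hDcard : D.card = 2 * Nat.card V := by
    rw [hD_def, Finset.card_union_of_disjoint hdisj, Finset.card_map, Finset.card_map, hVFc]; ring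
  have hmain := exists_simple_degenerate_of_model_balanced e (1, c₁) hc T
    (fun x => by
      obtain ⟨q, v⟩ := x
      rw [Prod.mk_mul_mk, one_mul]
      by_cases hq : q ∈ N
      · rw [hTin q v hq, hTin q (c₁ * v) hq]; exact hFcm v
      · rw [hTout q v hq, hTout q (c₁ * v) hq, not_not, hcF])
    (by
      rintro ⟨a, b⟩ hy
      by_contra hcon
      push Not at hcon
      -- `hcon : ∀ w, w ∈ T ↔ (a, b) * w ∈ T`
      by_cases hb1 : b = 1
      · subst hb1
        have ha : a ≠ 1 := fun ha => hy (Prod.ext ha rfl)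
        refine ha (hNstab a fun n hn => ?_)
        have h1 := hcon (n, v₁)
        rw [Prod.mk_mul_mk, one_mul, hTin n v₁ hn] at h1
        by_contra hout
        rw [hTout _ _ hout] at h1
        exact (h1.1 hv₁) hv₁
      by_cases hbc : b = c₁
      · subst hbc
        -- `(a, c₁)` would exchange `N` and `H ∖ N`: impossible, `|N| ≤ |H|/3`
        have hcv : b * v₁ ∉ F := (hFcm v₁).1 hv₁
        have hNc : ∀ q, q ∈ N ↔ a * q ∉ N := fun q => by
          have h1 := hcon (q, v₁)
          rw [Prod.mk_mul_mk] at h1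
          by_cases hq : q ∈ N
          · rw [hTin q v₁ hq] at h1
            refine ⟨fun _ haq => ?_, fun _ => hq⟩
            rw [hTin _ _ haq] at h1
            exact hcv (h1.1 hv₁)
          · rw [hTout q v₁ hq] at h1
            refine ⟨fun h => absurd h hq, fun haq => ?_⟩
            exfalso
            rw [hTout _ _ haq] at h1
            exact (h1.2 hcv) hv₁
        have hle1 : N.card ≤ (Finset.univ \ N).card :=
          Finset.card_le_card_of_injOn (fun q => a * q)
            (fun q hq => Finset.mem_coe.2 (Finset.mem_sdiff.2
              ⟨Finset.mem_univ _, (hNc q).1 (Finset.mem_coe.1 hq)⟩))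
            (fun q _ q' _ h => mul_left_cancel h)
        have hle2 : (Finset.univ \ N).card ≤ N.card :=
          Finset.card_le_card_of_injOn (fun q => a * q)
            (fun q hq => Finset.mem_coe.2 (by
              have hq' : q ∉ N := (Finset.mem_sdiff.1 (Finset.mem_coe.1 hq)).2
              by_contra h
              exact hq' ((hNc q).2 h)))
            (fun q _ q' _ h => mul_left_cancel h)
        rw [Finset.card_sdiff_of_subset (Finset.subset_univ _), Finset.card_univ] at hle1 hle2
        have hNpos : 0 < N.card := Finset.card_pos.2 ⟨1, hN1⟩
        have h3N : N.card * 3 ≤ N.card * Nat.card V := Nat.mul_le_mul_left _ h3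
        omega
      · -- `b ∉ {1, c₁}`: `b` or `c₁ b` would stabilise `F` (fibre over `1 ∈ N`)
        have hcb : c₁ * b ≠ 1 := fun h => hbc (by
          rw [← one_mul b, ← hcc, mul_assoc, h, mul_one])
        by_cases haN : a ∈ N
        · obtain ⟨v, hv⟩ := hFprim b hb1
          apply hv
          have h1 := hcon (1, v)
          rwa [Prod.mk_mul_mk, mul_one, hTin 1 v hN1, hTin a (b * v) haN] at h1
        · obtain ⟨v, hv⟩ := hFprim (c₁ * b) hcb
          apply hv
          have h1 := hcon (1, v)
          rwa [Prod.mk_mul_mk, mul_one, hTin 1 v hN1, hTout a (b * v) haN, ← hcF, ← mul_assoc] at h1)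
    D
    (fun g => by
      obtain ⟨g₀, w⟩ := g
      rw [hD_def, Finset.filter_union, Finset.card_union_of_disjoint (Finset.disjoint_filter_filter hdisj),
        Finset.filter_map, Finset.filter_map, Finset.card_map, Finset.card_map, hDcard]
      have e1 : VF.filter ((fun x : H × Γ => x * (g₀, w) ∈ T) ∘ ι₁) =
          VF.filter fun v => if w ∈ F then v * g₀ ∈ N else v * g₀ ∉ N := by
        refine Finset.filter_congr fun v _ => ?_
        change (v, (1 : Γ)) * (g₀, w) ∈ T ↔ _
        rw [Prod.mk_mul_mk, one_mul]
        by_cases hvg : v * g₀ ∈ N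
        · rw [hTin _ _ hvg]; by_cases hw : w ∈ F <;> simp [hw, hvg]
        · rw [hTout _ _ hvg]; by_cases hw : w ∈ F <;> simp [hw, hvg]
      have e2 : VF.filter ((fun x : H × Γ => x * (g₀, w) ∈ T) ∘ ι₂) =
          VF.filter fun v => if w ∈ F then v * (y₀ * g₀) ∉ N else v * (y₀ * g₀) ∈ N := by
        refine Finset.filter_congr fun v _ => ?_
        change (v * y₀, c₁) * (g₀, w) ∈ T ↔ _
        rw [Prod.mk_mul_mk, mul_assoc]
        by_cases hvg : v * (y₀ * g₀) ∈ N
        · rw [hTin _ _ hvg, hcF]; by_cases hw : w ∈ F <;> simp [hw, hvg]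
        · rw [hTout _ _ hvg, hcF, not_not]; by_cases hw : w ∈ F <;> simp [hw, hvg]
      rw [e1, e2]
      by_cases hw : w ∈ F
      · simp only [hw, if_true]
        rw [hrow g₀, hrow' (y₀ * g₀)]
        omega
      · simp only [hw, if_false]
        rw [hrow' g₀, hrow (y₀ * g₀)]
        omega)
    ⟨((1 : H), (1 : Γ)), Finset.mem_union_left _ (Finset.mem_map.2 ⟨1, (hmemV 1).2 V.one_mem, rfl⟩), fun h => by
      rw [Prod.mk_mul_mk, mul_one, mul_one, hD_def, Finset.mem_union] at h
      rcases h with h | h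
      · obtain ⟨v, -, hv⟩ := Finset.mem_map.1 h
        exact hc1 (Prod.ext_iff.1 hv).2.symm
      · obtain ⟨v, hv, hv'⟩ := Finset.mem_map.1 h
        have hvy : v * y₀ = 1 := (Prod.ext_iff.1 hv').1
        apply hy₀V
        rw [eq_inv_of_mul_eq_one_right hvy]
        exact V.inv_mem ((hmemV v).1 hv)⟩
  rwa [Fintype.card_prod] at hmain

end Transversal

end Summit.HodgeConjecture.CorCM.GaloisModels

end
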